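import Literature.Computability.Complexity.BoundedArithmeticHerbrandData
import HarnessLib

/-!
# Discharge of the model-theoretic form of Buss's conservation theorem

Sibling proof file of `Literature.Computability.Complexity.BoundedArithmeticConservation` (no new
definitions; it cannot live in that file, which is imported by the route files used here).
That file states, as the named fact `T2_hasPibPreservingMap_S2_succ`, the *model-theoretic form*
of Buss's theorem "`S₂ⁱ⁺¹` is `∀Σᵇᵢ₊₁`-conservative over `T₂ⁱ`, `i ≥ 1`" (Buss 1990, Thm. 5,
p. 8 of the paper = Contemp. Math. 106, p. 64): every model `M ⊨ T₂ⁱ` maps `Πᵇᵢ₊₁`-preservingly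
into a model of `S₂ⁱ⁺¹` (the statement established by the model-theoretic proofs of the theorem,
Krajíček 1995, Thm. 7.6.3 and pp. 116–117, after Zambella 1996; Avigad 2002, §4), and proves it
equivalent to the conservativity statement `S2_succ_isConservativeOver_T2`
(`t2_hasPibPreservingMap_S2_succ_iff`).

Here the fact is **proved** (D-0014 discharge), in two ways that the tree now affords:

* `T2_hasPibPreservingMap_S2_succ_holds` — directly from the Herbrand-saturation route: for
  `i = k + 1` the data `herbrandRouteData_qsym k` (`BoundedArithmeticHerbrandData.lean`: the
  language `Language.qsym k` of query-presentable function symbols, the universal theory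
  `QSym.univTheory k` of the canonical expansions of models of `T₂ᵏ⁺¹`, universal companions of
  `Πᵇₖ₊₂` formulas, and `Σᵇₖ₊₂`-PIND in Herbrand-saturated models, Buss 1990 §§3–4 carried out
  semantically in `Literature/Computability/MetaComplexity/BoundedArithUniv*.lean`) fed to
  `t2_hasPibPreservingMap_S2_succ_of_herbrandRouteData` (`BoundedArithmeticHerbrand.lean`,
  Avigad 2002, Thm. 3.2: expand `M`, embed it universal-preservingly into an Herbrand-saturated
  model `K ⊨ S₂ⁱ⁺¹`, read `Πᵇᵢ₊₁` formulas through their universal companions);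
* `T2_hasPibPreservingMap_S2_succ_holds'` — from Buss's theorem itself,
  `S2_succ_isConservativeOver_T2_holds` (`BoundedArithmeticHerbrandData.lean`), through the
  compactness direction `t2_hasPibPreservingMap_S2_succ_of_isConservativeOver` of the in-file
  equivalence (Krajíček 1995, pp. 116–117, read backwards).

## References

* S. R. Buss, *Axiomatizations and conservation results for fragments of bounded arithmetic*,
  in: Logic and Computation, Contemp. Math. 106, AMS 1990, 57–84: Thm. 5 (p. 8 of the paper).
* J. Krajíček, *Bounded Arithmetic, Propositional Logic and Complexity Theory*, CUP 1995,
  Thm. 7.6.3 and pp. 116–117.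
* J. Avigad, *Saturated models of universal theories*, Ann. Pure Appl. Logic 118 (2002), Thm. 3.2,
  Thm. 3.4, §4.
* D. Zambella, *Notes on polynomially bounded arithmetic*, J. Symbolic Logic 61 (1996), 942–966.
-/

namespace Literature.Computability.Complexity

open FirstOrder FirstOrder.Language
open Literature.Computability.MetaComplexity

/-- **Discharge of `T2_hasPibPreservingMap_S2_succ`** (model-theoretic form of Buss 1990, Thm. 5:
for every `i ≥ 1`, every model of `T₂ⁱ` maps `Πᵇᵢ₊₁`-preservingly into a model of `S₂ⁱ⁺¹`),
by the Herbrand-saturation route: the data `herbrandRouteData_qsym (i - 1)` for the language of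
query-presentable symbols and the universal theory of the canonical expansions of models of `T₂ⁱ`
(Buss 1990, §§3–4, model-theoretically), assembled by
`t2_hasPibPreservingMap_S2_succ_of_herbrandRouteData` (Avigad 2002, Thm. 3.2; Krajíček 1995,
Thm. 7.6.3 and pp. 116–117). [cite: BussContempMath1990, Thm. 5 (p. 8 of the paper; model-theoretic form)] -/
theorem T2_hasPibPreservingMap_S2_succ_holds : T2_hasPibPreservingMap_S2_succ :=
  t2_hasPibPreservingMap_S2_succ_of_herbrandRouteData
    (L' := fun i => Language.qsym (i - 1)) (fun i => qsymι (i - 1))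
    (fun i => QSym.univTheory (i - 1)) fun i hi => by
      obtain ⟨k, rfl⟩ : ∃ k, i = k + 1 := ⟨i - 1, (Nat.sub_add_cancel hi).symm⟩
      exact herbrandRouteData_qsym k

/-- The same fact obtained from Buss's conservation theorem `S2_succ_isConservativeOver_T2_holds`
(Buss 1990, Thm. 5) by compactness and the `Πᵇᵢ₊₁`-diagram
(`t2_hasPibPreservingMap_S2_succ_of_isConservativeOver`; Krajíček 1995, pp. 116–117).
[cite: BussContempMath1990, Thm. 5 (p. 8 of the paper)] -/
theorem T2_hasPibPreservingMap_S2_succ_holds' : T2_hasPibPreservingMap_S2_succ :=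
  t2_hasPibPreservingMap_S2_succ_of_isConservativeOver S2_succ_isConservativeOver_T2_holds

end Literature.Computability.Complexity
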